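import Summits.HubbardSuperconductivity.HubbardSuperconductivity.Theorems.BalabanIRBirEveryGroundStateSocketClosers
import Summits.HubbardSuperconductivity.HubbardSuperconductivity.Theorems.BalabanIRBirEveryGroundStatePencil
import Summits.HubbardSuperconductivity.HubbardSuperconductivity.Theorems.BalabanIRBirEveryGroundStateSchur
import Literature.MathematicalPhysics.QuantumLattice.HubbardWave0RepulsiveProofs
import Literature.MathematicalPhysics.QuantumLattice.PairFieldMomentum

/-!
# Route `BalabanIR`, crux 5 `BirEveryGroundState` (`stmt-HubbardSuperconductivity-2083`):
# Theses-free CLOSERS from the residual hypotheses of the three lines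

Companion of `BalabanIRBirEveryGroundStateSocket.lean` / `…SocketClosers.lean` and, like them,
importing NO route file (`…Theses.BalabanIR`) and no Theorems module that does (rev-5
MATERIALISATION RULE; `…Pencil.lean` and `…Schur.lean` are route-file-free since their 2026-08-16
revisions). The route-file-importing helpers `BalabanIRBirEveryGroundStateResidue.lean` and
`BalabanIRBirEveryGroundStateClosures.lean` prove the crux BY NAME modulo the residual hypothesis
of each proposed line; this module re-establishes the three reductions STRUCTURALLY — conclusion =
the item's body verbatim — so that a future Theses-free proof `h` of any one residual closes the
item by a three-line file `theorem birEveryGroundState_proof : <body> := <closer> h`.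

* `birEveryGroundState_structural_of_darkPartnerExclusion` (line `integer-pencil-schur-residue`):
  its selection stub is the theorem `exists_coupling_forall_card_roots_le_hubbardTorus` (every
  open window contains ONE coupling `U` at which, for every torus side `L` at once, the number of
  distinct eigenvalues of `hubbardTorus 2 L 1 U` is maximal over all real couplings); its residue
  `hdark` (the card's `DarkPartnerExclusion`): at such a coupling, eventually in even `L`,
  `Δ_d† Δ_d` has scalar matrix elements on the sector ground eigenspace.
* `birEveryGroundState_structural_of_irreducibleGround` (lines `generic-u-schur-every-gs`,
  `commutant-schur-pair-invariance`): residue `hirr` — at a dense set of couplings, eventually in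
  even `L`, the sector ground eigenspace `E₀(U, L)` is irreducible under the joint commutant of
  `H`, `N̂`, `S^z`, `Δ_d† Δ_d`; Schur (`exists_scalar_matrixElements_of_irreducible`) makes the
  compression scalar.
* `birEveryGroundState_structural_of_kappaChord` (line `kappa-chord-transfer`): residue `hchord`
  — the window average yields a coupling and `κ, a > 0` with an eventual chord bound
  `κ a ≤ minEnergyOn (H + κ L⁻⁴ Δ_d† Δ_d) S_L - minEnergyOn H S_L`; the chord inequality
  (`chord_div_le_re_expect_of_eigen`) gives every normalised sector ground state
  `a L⁴ ≤ re ⟨ψ, Δ_d† Δ_d ψ⟩`, and the socket `birEveryGroundState_structural_of_transfer`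
  concludes.

None of the three residual hypotheses is proved here (no printed source decides them;
Bruus–Anglès d'Auriac, PRB 55 (1997) 9142, §5 is the nearest numerical study of ground-state
degeneracies of Hubbard tori). Kato (1966) Ch. II §1.1, §6.1; Serre, *Linear Representations of
Finite Groups*, §2.2; Tasaki (2020) §2.1, §9.3. Everything else is folklore; no definition is
introduced.
-/
noncomputable section

namespace Summit.HubbardSuperconductivity.HubbardSuperconductivity.Theorems

open Matrix Finset
open Literature.Probability.LatticeModels Literature.MathematicalPhysics.QuantumLattice
open scoped ComplexOrder

/-- **CLOSER ⇐ no dark ground partner at non-exceptional couplings** (Theses-free form of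
`birEveryGroundState_of_darkPartnerExclusion`). Suppose that for every doping `δ ∈ (0, 1/2)` and
every coupling `U > 0` which is NON-EXCEPTIONAL FOR ALL TORUS SIDES — for every `L` the number of
distinct eigenvalues of `hubbardTorus 2 L 1 U` is maximal over all real couplings — there is a
threshold beyond which, at even sides `L`, `Δ_d† Δ_d` has scalar matrix elements on the sector
ground eigenspace `E₀(U, L) = szSector N_L 0 ⊓ ker (H - e₀)` (`hdark`; NOT proved). Then the body
of `Theses.BalabanIR.BirEveryGroundState` holds, verbatim: every window `(U₁, U₂) ⊂ (0, ∞)`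
contains such a coupling (`exists_coupling_forall_card_roots_le_hubbardTorus`), where `hdark`
supplies the scalar compression and `birEveryGroundState_structural_of_scalarOnGround` concludes.
Kato (1966) Ch. II §1.1; Serre §2.2. [folklore] -/
theorem birEveryGroundState_structural_of_darkPartnerExclusion
    (hdark : ∀ δ ∈ Set.Ioo (0:ℝ) (1/2), ∀ U : ℝ, 0 < U →
      (∀ (L : ℕ) (u' : ℝ), (hubbardTorus 2 L 1 u').charpoly.roots.toFinset.card ≤
        (hubbardTorus 2 L 1 U).charpoly.roots.toFinset.card) →
      ∃ L₀ : ℕ, ∀ (L : ℕ) [NeZero L], L₀ ≤ L → Even L →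
        let N : ℕ := 2 * ⌊(1 - δ) * (L : ℝ) ^ 2 / 2⌋₊
        let H := hubbardTorus 2 L 1 U
        let S := szSector (Λ := FermionTorus 2 L) N 0
        let E₀ := S ⊓ Module.End.eigenspace (Matrix.toLin' H) ((H.minEnergyOn S : ℝ) : ℂ)
        ∃ μ : ℂ, ∀ v ∈ E₀, ∀ w ∈ E₀,
          star w ⬝ᵥ ((pairField dWaveFormFactor L)ᴴ * pairField dWaveFormFactor L) *ᵥ v =
            μ * (star w ⬝ᵥ v)) :
    ∀ (δ U₁ U₂ c : ℝ), δ ∈ Set.Ioo (0:ℝ) (1/2) → 0 < U₁ → U₁ < U₂ → 0 < c → (∀ U ∈ Set.Ioo U₁ U₂, ∃ L₀ : ℕ, ∀ (L : ℕ) [NeZero L], L₀ ≤ L → Even L → let N : ℕ := 2 * ⌊(1 - δ) * (L : ℝ) ^ 2 / 2⌋₊; let H := Literature.MathematicalPhysics.QuantumLattice.hubbardTorus 2 L 1 U; let S := Literature.MathematicalPhysics.QuantumLattice.szSector (Λ := Literature.MathematicalPhysics.QuantumLattice.FermionTorus 2 L) N 0; let E₀ := S ⊓ Module.End.eigenspace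 (Matrix.toLin' H) ((H.minEnergyOn S : ℝ) : ℂ); let P := Literature.MathematicalPhysics.QuantumLattice.projMatrix (E₀.map (Literature.MathematicalPhysics.QuantumLattice.Fock.toEuclidean (ι := Literature.MathematicalPhysics.QuantumLattice.Orb (Literature.MathematicalPhysics.QuantumLattice.FermionTorus 2 L)) : Literature.MathematicalPhysics.QuantumLattice.Fock (Literature.MathematicalPhysics.QuantumLattice.Orb (Literature.MathematicalPhysics.QuantumLattice.FermionTorus 2 L)) →ₗ[ℂ] EuclideanSpace ℂ (Finset (Literature.MathematicalPhysics.QuantumLattice.Orb (Literature.MathematicalPhysics.QuantumLattice.FermionTorus 2 L))))); c * (L : ℝ) ^ 4 * P.trace.re ≤ (P * (Matrix.conjTranspose (Literature.MathematicalPhysics.QuantumLattice.pairField Literature.MathematicalPhysics.QuantumLattice.dWaveFormFactor L) * Literature.MathematicalPhysics.QuantumLattice.pairField Literature.MathematicalPhysics.QuantumLattice.dWaveFormFactor L)).trace.re) → ∃ U ∈ Set.Ioo U₁ U₂, ∀ (N : ℕ → ℕ) (ψ : ∀ L, Literature.MathematicalPhysics.QuantumLattice.Fock (Literature.MathematicalPhysics.QuantumLattice.Orb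 (Literature.MathematicalPhysics.QuantumLattice.FermionTorus 2 L))), (∀ L, Even L → N L = 2 * ⌊(1 - δ) * (L : ℝ) ^ 2 / 2⌋₊ ∧ star (ψ L) ⬝ᵥ ψ L = 1 ∧ Literature.MathematicalPhysics.QuantumLattice.IsGroundStateInSector (Literature.MathematicalPhysics.QuantumLattice.hubbardTorus 2 L 1 U) (N L) 0 (ψ L)) → Literature.Probability.LatticeModels.HasLongRangeOrder (fun k => Literature.Probability.LatticeModels.halfOpenBox 2 (2 * k)) (fun k => Literature.MathematicalPhysics.QuantumLattice.torusPullback (Literature.MathematicalPhysics.QuantumLattice.pairFieldCorr Literature.MathematicalPhysics.QuantumLattice.dWaveFormFactor ψ) (2 * k)) := by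
  refine birEveryGroundState_structural_of_scalarOnGround fun δ hδ U₁ U₂ hU₁ hU₁₂ => ?_
  obtain ⟨U, hU, hmax⟩ := exists_coupling_forall_card_roots_le_hubbardTorus hU₁₂
  exact ⟨U, hU, hdark δ hδ U (hU₁.trans hU.1) hmax⟩

/-- **CLOSER ⇐ irreducible ground multiplets at a dense set of couplings** (Theses-free form of
`birEveryGroundState_of_irreducibleGround`). Suppose that for every `δ ∈ (0, 1/2)` and every open
window `(U₁, U₂) ⊂ (0, ∞)` there is a coupling `U` in the window such that, eventually in even
`L`, the sector ground eigenspace `E₀(U, L) = szSector N_L 0 ⊓ ker (H - e₀)` of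
`H = hubbardTorus 2 L 1 U` has no subspace other than `⊥` and itself invariant under every matrix
`X` commuting with `H`, `N̂`, `S^z` and `Y = Δ_d† Δ_d` (irreducibility under the joint commutant —
it contains translations, `D₄`, spin rotations; `hirr`, NOT proved). Then the body of
`Theses.BalabanIR.BirEveryGroundState` holds: the commutant preserves `E₀` (it preserves `N̂`-,
`S^z`- and `H`-eigenvectors) and is `ᴴ`-closed (`H`, `N̂`, `S^z`, `Y` are Hermitian), so by Schur
(`exists_scalar_matrixElements_of_irreducible`) the matrix elements of `Y` on `E₀(U, L)` are
scalar, and `birEveryGroundState_structural_of_scalarOnGround` applies. Serre §2.2; Tasaki (2020)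
§9.3.2; Kato (1966) II §6.1. [folklore] -/
theorem birEveryGroundState_structural_of_irreducibleGround
    (hirr : ∀ δ ∈ Set.Ioo (0:ℝ) (1/2), ∀ U₁ U₂ : ℝ, 0 < U₁ → U₁ < U₂ →
      ∃ U ∈ Set.Ioo U₁ U₂, ∃ L₀ : ℕ, ∀ (L : ℕ) [NeZero L], L₀ ≤ L → Even L →
        let N : ℕ := 2 * ⌊(1 - δ) * (L : ℝ) ^ 2 / 2⌋₊
        let H := hubbardTorus 2 L 1 U
        let S := szSector (Λ := FermionTorus 2 L) N 0
        let E₀ := S ⊓ Module.End.eigenspace (Matrix.toLin' H) ((H.minEnergyOn S : ℝ) : ℂ)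
        let Y : Matrix (Finset (Orb (FermionTorus 2 L))) (Finset (Orb (FermionTorus 2 L))) ℂ :=
          (pairField dWaveFormFactor L)ᴴ * pairField dWaveFormFactor L
        ∀ K' : Submodule ℂ (Fock (Orb (FermionTorus 2 L))), K' ≤ E₀ →
          (∀ X : Matrix (Finset (Orb (FermionTorus 2 L))) (Finset (Orb (FermionTorus 2 L))) ℂ,
            X * H = H * X → X * totalNumber = totalNumber * X →
            X * HubbardWave0.spinZ = HubbardWave0.spinZ * X → X * Y = Y * X →
            ∀ v ∈ K', X *ᵥ v ∈ K') →
          K' = ⊥ ∨ K' = E₀) :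
    ∀ (δ U₁ U₂ c : ℝ), δ ∈ Set.Ioo (0:ℝ) (1/2) → 0 < U₁ → U₁ < U₂ → 0 < c → (∀ U ∈ Set.Ioo U₁ U₂, ∃ L₀ : ℕ, ∀ (L : ℕ) [NeZero L], L₀ ≤ L → Even L → let N : ℕ := 2 * ⌊(1 - δ) * (L : ℝ) ^ 2 / 2⌋₊; let H := Literature.MathematicalPhysics.QuantumLattice.hubbardTorus 2 L 1 U; let S := Literature.MathematicalPhysics.QuantumLattice.szSector (Λ := Literature.MathematicalPhysics.QuantumLattice.FermionTorus 2 L) N 0; let E₀ := S ⊓ Module.End.eigenspace (Matrix.toLin' H) ((H.minEnergyOn S : ℝ) : ℂ); let P := Literature.MathematicalPhysics.QuantumLattice.projMatrix (E₀.map (Literature.MathematicalPhysics.QuantumLattice.Fock.toEuclidean (ι := Literature.MathematicalPhysics.QuantumLattice.Orb (Literature.MathematicalPhysics.QuantumLattice.FermionTorus 2 L)) : Literature.MathematicalPhysics.QuantumLattice.Fock (Literature.MathematicalPhysics.QuantumLattice.Orb (Literature.MathematicalPhysics.QuantumLattice.FermionTorus 2 L)) →ₗ[ℂ] EuclideanSpace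 ℂ (Finset (Literature.MathematicalPhysics.QuantumLattice.Orb (Literature.MathematicalPhysics.QuantumLattice.FermionTorus 2 L))))); c * (L : ℝ) ^ 4 * P.trace.re ≤ (P * (Matrix.conjTranspose (Literature.MathematicalPhysics.QuantumLattice.pairField Literature.MathematicalPhysics.QuantumLattice.dWaveFormFactor L) * Literature.MathematicalPhysics.QuantumLattice.pairField Literature.MathematicalPhysics.QuantumLattice.dWaveFormFactor L)).trace.re) → ∃ U ∈ Set.Ioo U₁ U₂, ∀ (N : ℕ → ℕ) (ψ : ∀ L, Literature.MathematicalPhysics.QuantumLattice.Fock (Literature.MathematicalPhysics.QuantumLattice.Orb (Literature.MathematicalPhysics.QuantumLattice.FermionTorus 2 L))), (∀ L, Even L → N L = 2 * ⌊(1 - δ) * (L : ℝ) ^ 2 / 2⌋₊ ∧ star (ψ L) ⬝ᵥ ψ L = 1 ∧ Literature.MathematicalPhysics.QuantumLattice.IsGroundStateInSector (Literature.MathematicalPhysics.QuantumLattice.hubbardTorus 2 L 1 U) (N L) 0 (ψ L)) → Literature.Probability.LatticeModels.HasLongRangeOrder (fun k => Literature.Probability.LatticeModels.halfOpenBox 2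 (2 * k)) (fun k => Literature.MathematicalPhysics.QuantumLattice.torusPullback (Literature.MathematicalPhysics.QuantumLattice.pairFieldCorr Literature.MathematicalPhysics.QuantumLattice.dWaveFormFactor ψ) (2 * k)) := by
  refine birEveryGroundState_structural_of_scalarOnGround fun δ hδ U₁ U₂ hU₁ hU₁₂ => ?_
  obtain ⟨U, hU, L₀, hL₀⟩ := hirr δ hδ U₁ U₂ hU₁ hU₁₂
  refine ⟨U, hU, L₀, fun L _ hL hLe => ?_⟩
  have hirrL := hL₀ L hL hLe
  simp only at hirrL ⊢
  -- name the objects of side `L`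
  set Y : Matrix (Finset (Orb (FermionTorus 2 L))) (Finset (Orb (FermionTorus 2 L))) ℂ :=
    (pairField dWaveFormFactor L)ᴴ * pairField dWaveFormFactor L with hY
  set H := hubbardTorus 2 L 1 U with hH
  set Sec := szSector (Λ := FermionTorus 2 L) (2 * ⌊(1 - δ) * (L : ℝ) ^ 2 / 2⌋₊) 0 with hSec
  set E₀ := Sec ⊓ Module.End.eigenspace (Matrix.toLin' H) ((H.minEnergyOn Sec : ℝ) : ℂ) with hE₀
  -- a matrix commuting with `H`, `N̂`, `S^z` maps the sector ground eigenspace into itself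
  have hpres : ∀ X : Matrix (Finset (Orb (FermionTorus 2 L))) (Finset (Orb (FermionTorus 2 L))) ℂ,
      X * H = H * X → X * totalNumber = totalNumber * X →
      X * HubbardWave0.spinZ = HubbardWave0.spinZ * X → ∀ v ∈ E₀, X *ᵥ v ∈ E₀ := by
    intro X h1 h2 h3 v hv
    obtain ⟨hvS, hvE⟩ := Submodule.mem_inf.mp hv
    rw [mem_szSector_iff, LiebTwo.isNParticle_iff_totalNumber] at hvS
    rw [Module.End.mem_eigenspace_iff, Matrix.toLin'_apply] at hvE
    refine Submodule.mem_inf.mpr ⟨?_, ?_⟩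
    · rw [mem_szSector_iff, LiebTwo.isNParticle_iff_totalNumber]
      refine ⟨?_, ?_⟩
      · rw [mulVec_mulVec, ← h2, ← mulVec_mulVec, hvS.1, mulVec_smul]
      · rw [mulVec_mulVec, ← h3, ← mulVec_mulVec, hvS.2, mulVec_smul]
    · rw [Module.End.mem_eigenspace_iff, Matrix.toLin'_apply, mulVec_mulVec, ← h1, ← mulVec_mulVec,
        hvE, mulVec_smul]
  -- the joint commutant
  let Sym : Set (Matrix (Finset (Orb (FermionTorus 2 L))) (Finset (Orb (FermionTorus 2 L))) ℂ) :=
    {X | X * H = H * X ∧ X * totalNumber = totalNumber * X ∧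
      X * HubbardWave0.spinZ = HubbardWave0.spinZ * X ∧ X * Y = Y * X}
  have hSA : ∀ X ∈ Sym, X * Y = Y * X := fun X hX => hX.2.2.2
  have hSK : ∀ X ∈ Sym, ∀ v ∈ E₀, X *ᵥ v ∈ E₀ := fun X hX v hv =>
    hpres X hX.1 hX.2.1 hX.2.2.1 v hv
  -- the commutant is `ᴴ`-closed (`H`, `N̂`, `S^z`, `Y` are Hermitian)
  have hSK' : ∀ X ∈ Sym, ∀ v ∈ E₀, Xᴴ *ᵥ v ∈ E₀ := fun X hX v hv =>
    hpres Xᴴ (conjTranspose_commute_of_commute (LiebThm1.hamiltonian_isHermitian _ 1 U) hX.1)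
      (conjTranspose_commute_of_commute totalNumber_isHermitian hX.2.1)
      (conjTranspose_commute_of_commute HubbardWave0.spinZ_isHermitian hX.2.2.1) v hv
  have hirr' : ∀ K' : Submodule ℂ (Fock (Orb (FermionTorus 2 L))), K' ≤ E₀ →
      (∀ X ∈ Sym, ∀ v ∈ K', X *ᵥ v ∈ K') → K' = ⊥ ∨ K' = E₀ := fun K' hK' hinv =>
    hirrL K' hK' fun X h1 h2 h3 h4 v hv => hinv X ⟨h1, h2, h3, h4⟩ v hv
  exact exists_scalar_matrixElements_of_irreducible E₀ Y Sym hSA hSK hSK' hirr'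

/-- **CLOSER ⇐ a κ-chord bound at one coupling of the window** (Theses-free form of
`birEveryGroundState_of_kappaChord`, line `kappa-chord-transfer`). Suppose that for all data
`(δ, U₁, U₂, c)` the window-average hypothesis of the crux yields a coupling `U ∈ (U₁, U₂)` and
constants `κ, a > 0` with, eventually in even `L`,
`κ a ≤ minEnergyOn (H + κ Y_L) S_L - minEnergyOn H S_L` for `H = hubbardTorus 2 L 1 U`,
`S_L = szSector N_L 0` and the normalised structure factor `Y_L = L⁻⁴ Δ_d† Δ_d` (`hchord`, NOT
proved). Then the body of `Theses.BalabanIR.BirEveryGroundState` holds: by the chord inequality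
(`chord_div_le_re_expect_of_eigen`) every normalised sector ground state `ψ` has
`a ≤ (minEnergyOn (H + κ Y_L) S_L - minEnergyOn H S_L) / κ ≤ re ⟨ψ, Y_L ψ⟩ = L⁻⁴ re ⟨ψ, Δ_d† Δ_d ψ⟩`,
i.e. the every-ground-state bound with constant `a`, and the socket
`birEveryGroundState_structural_of_transfer` concludes. Tasaki (2020) §2.1 (variational
principle). [folklore] -/
theorem birEveryGroundState_structural_of_kappaChord
    (hchord : ∀ (δ U₁ U₂ c : ℝ), δ ∈ Set.Ioo (0:ℝ) (1/2) → 0 < U₁ → U₁ < U₂ → 0 < c →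
      (∀ U ∈ Set.Ioo U₁ U₂, ∃ L₀ : ℕ, ∀ (L : ℕ) [NeZero L], L₀ ≤ L → Even L →
        let N : ℕ := 2 * ⌊(1 - δ) * (L : ℝ) ^ 2 / 2⌋₊
        let H := hubbardTorus 2 L 1 U
        let S := szSector (Λ := FermionTorus 2 L) N 0
        let E₀ := S ⊓ Module.End.eigenspace (Matrix.toLin' H) ((H.minEnergyOn S : ℝ) : ℂ)
        let P := projMatrix (E₀.map (Fock.toEuclidean (ι := Orb (FermionTorus 2 L)) :
          Fock (Orb (FermionTorus 2 L)) →ₗ[ℂ] EuclideanSpace ℂ (Finset (Orb (FermionTorus 2 L)))))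
        c * (L : ℝ) ^ 4 * P.trace.re ≤
          (P * ((pairField dWaveFormFactor L)ᴴ * pairField dWaveFormFactor L)).trace.re) →
      ∃ U ∈ Set.Ioo U₁ U₂, ∃ κ a : ℝ, 0 < κ ∧ 0 < a ∧ ∃ L₀ : ℕ, ∀ (L : ℕ) [NeZero L],
        L₀ ≤ L → Even L →
        let N : ℕ := 2 * ⌊(1 - δ) * (L : ℝ) ^ 2 / 2⌋₊
        let H := hubbardTorus 2 L 1 U
        let S := szSector (Λ := FermionTorus 2 L) N 0
        let Yd : Matrix (Finset (Orb (FermionTorus 2 L))) (Finset (Orb (FermionTorus 2 L))) ℂ :=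
          ((1 : ℂ) / (L : ℂ) ^ 4) •
            ((pairField dWaveFormFactor L)ᴴ * pairField dWaveFormFactor L)
        κ * a ≤ (H + (κ : ℂ) • Yd).minEnergyOn S - H.minEnergyOn S) :
    ∀ (δ U₁ U₂ c : ℝ), δ ∈ Set.Ioo (0:ℝ) (1/2) → 0 < U₁ → U₁ < U₂ → 0 < c → (∀ U ∈ Set.Ioo U₁ U₂, ∃ L₀ : ℕ, ∀ (L : ℕ) [NeZero L], L₀ ≤ L → Even L → let N : ℕ := 2 * ⌊(1 - δ) * (L : ℝ) ^ 2 / 2⌋₊; let H := Literature.MathematicalPhysics.QuantumLattice.hubbardTorus 2 L 1 U; let S := Literature.MathematicalPhysics.QuantumLattice.szSector (Λ := Literature.MathematicalPhysics.QuantumLattice.FermionTorus 2 L) N 0; let E₀ := S ⊓ Module.End.eigenspace (Matrix.toLin' H) ((H.minEnergyOn S : ℝ) : ℂ); let P := Literature.MathematicalPhysics.QuantumLattice.projMatrix (E₀.map (Literature.MathematicalPhysics.QuantumLattice.Fock.toEuclidean (ι := Literature.MathematicalPhysics.QuantumLattice.Orb (Literature.MathematicalPhysics.QuantumLattice.FermionTorus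 2 L)) : Literature.MathematicalPhysics.QuantumLattice.Fock (Literature.MathematicalPhysics.QuantumLattice.Orb (Literature.MathematicalPhysics.QuantumLattice.FermionTorus 2 L)) →ₗ[ℂ] EuclideanSpace ℂ (Finset (Literature.MathematicalPhysics.QuantumLattice.Orb (Literature.MathematicalPhysics.QuantumLattice.FermionTorus 2 L))))); c * (L : ℝ) ^ 4 * P.trace.re ≤ (P * (Matrix.conjTranspose (Literature.MathematicalPhysics.QuantumLattice.pairField Literature.MathematicalPhysics.QuantumLattice.dWaveFormFactor L) * Literature.MathematicalPhysics.QuantumLattice.pairField Literature.MathematicalPhysics.QuantumLattice.dWaveFormFactor L)).trace.re) → ∃ U ∈ Set.Ioo U₁ U₂, ∀ (N : ℕ → ℕ) (ψ : ∀ L, Literature.MathematicalPhysics.QuantumLattice.Fock (Literature.MathematicalPhysics.QuantumLattice.Orb (Literature.MathematicalPhysics.QuantumLattice.FermionTorus 2 L))), (∀ L, Even L → N L = 2 * ⌊(1 - δ) * (L : ℝ) ^ 2 / 2⌋₊ ∧ star (ψ L) ⬝ᵥ ψ L = 1 ∧ Literature.MathematicalPhysics.QuantumLattice.IsGroundStateInSector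 (Literature.MathematicalPhysics.QuantumLattice.hubbardTorus 2 L 1 U) (N L) 0 (ψ L)) → Literature.Probability.LatticeModels.HasLongRangeOrder (fun k => Literature.Probability.LatticeModels.halfOpenBox 2 (2 * k)) (fun k => Literature.MathematicalPhysics.QuantumLattice.torusPullback (Literature.MathematicalPhysics.QuantumLattice.pairFieldCorr Literature.MathematicalPhysics.QuantumLattice.dWaveFormFactor ψ) (2 * k)) := by
  refine birEveryGroundState_structural_of_transfer fun δ U₁ U₂ c hδ hU₁ hU₁₂ hc hyp => ?_
  obtain ⟨U, hU, κ, a, hκ, ha, L₀, hL₀⟩ := hchord δ U₁ U₂ c hδ hU₁ hU₁₂ hc hyp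
  refine ⟨U, hU, a, ha, L₀, fun L _ hL hLe ψ hgs hunit => ?_⟩
  have hgap := hL₀ L hL hLe
  simp only at hgap
  -- name the objects of side `L`
  set A : Matrix (Finset (Orb (FermionTorus 2 L))) (Finset (Orb (FermionTorus 2 L))) ℂ :=
    (pairField dWaveFormFactor L)ᴴ * pairField dWaveFormFactor L with hA
  set H := hubbardTorus 2 L 1 U with hH
  set S := szSector (Λ := FermionTorus 2 L) (2 * ⌊(1 - δ) * (L : ℝ) ^ 2 / 2⌋₊) 0 with hS
  set Yd : Matrix (Finset (Orb (FermionTorus 2 L))) (Finset (Orb (FermionTorus 2 L))) ℂ :=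
    ((1 : ℂ) / (L : ℂ) ^ 4) • A with hYd
  -- the chord inequality for the ground state `ψ`
  have hch := chord_div_le_re_expect_of_eigen H Yd S hκ hgs.1 hunit hgs.2.2
  have hL4 : (0 : ℝ) < (L : ℝ) ^ 4 := by
    have : (0 : ℝ) < (L : ℝ) := Nat.cast_pos.mpr (Nat.pos_of_ne_zero (NeZero.ne L))
    positivity
  -- `⟨ψ, Y_L ψ⟩ = L⁻⁴ ⟨ψ, Δ_d† Δ_d ψ⟩`
  have hexp : (star ψ ⬝ᵥ Yd *ᵥ ψ).re = (star ψ ⬝ᵥ A *ᵥ ψ).re / (L : ℝ) ^ 4 := by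
    have hcast : ((1 : ℂ) / (L : ℂ) ^ 4) = (((1 : ℝ) / (L : ℝ) ^ 4 : ℝ) : ℂ) := by push_cast; ring
    rw [hYd, smul_mulVec, dotProduct_smul, smul_eq_mul, hcast, Complex.re_ofReal_mul]
    ring
  have ha' : a ≤ ((H + (κ : ℂ) • Yd).minEnergyOn S - H.minEnergyOn S) / κ := by
    rw [le_div_iff₀ hκ, mul_comm]
    exact hgap
  have key : a ≤ (star ψ ⬝ᵥ A *ᵥ ψ).re / (L : ℝ) ^ 4 := by
    rw [← hexp]
    exact ha'.trans hch
  rwa [le_div_iff₀ hL4] at key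

end Summit.HubbardSuperconductivity.HubbardSuperconductivity.Theorems
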